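import Summits.Ventures.CertifiedManyBodySolver.Downfold.EmeryThermalSeam
import Literature.MathematicalPhysics.QuantumLattice.EmeryThreeBandBlock2x2BoostSectorCap
import HarnessLib

/-!
# The thermal CAP ORDER in device form: 25 particle-number sector floors of the BOOSTED `Cu₄O₈` cluster at each of the four lower-face corners
# ⇒ the cell-pressure cap word on the whole typed Emery box (composition of hubbard-box-p1 g16's R148/R150 with `EmeryThermalSeam` §2)

Venture CertifiedManyBodySolver, cell `pub/hubbard-downfold` (S1 = ROUTER) × crew hubbard-fast S2 «multi-band × T > 0» (D-0096 (ii)); seat hubbard-downfold-mod-4.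
Namespace `Summit.Ventures.CertifiedManyBodySolver.Downfold`. hubbard-box-p1 g16 DELIVERY #2 (hubbard-fast INBOX 13:13:42Z): `PartitionFnSectorFloorCap` (p633830,
`ClusterLowerBound.log_partitionFn_hubbardOpenBoxGP_le_of_sector_floors`: floors `q k ≤ E₀(h^G, k)` for every particle number `k ≤ 2ab` ⇒
`log Re Z_β(h^G) ≤ log Σ_{p,p' ≤ ab} C(ab,p) C(ab,p') e^{−β q(p+p')}`) and `EmeryThreeBandBlock2x2BoostDictionary` (p635952: the boundary-BOOSTED `Cu₄O₈` block by rank is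
`hubbardOpenBoxGP 1 12 (boostTau θ) (blockUps θ) (blockNu θ)`, `boostTau_symm`, `emeryCellPressure_le_of_log_partitionFn_boostGP_le`: `log Re Z ≤ u ⇒ P_cell ≤ u/4`).
box-p1's DELIVERY #3 (13:27:16Z) composed the two itself: `EmeryThreeBandBlock2x2BoostSectorCap` (p636988, R152: `emeryCellPressure_le_of_boost_sector_floors (hβ) θ hq :
4·P_cell ≤ log Σ…`). THIS FILE puts that corner-cap producer through the corner-cap door of `EmeryThermalSeam` §2:

* `emeryCellPressure_le_of_boostSectorFloors` — the per-CuO₂ (`÷ 4`) restatement of R152 for one coupling vector;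
* **`holdsOn_emeryCellPressureCap_of_boostSectorFloors`** — a typed Emery box, `β ≥ 0`: sector floors `q i k` of the boosted block at the FOUR lower-face corners
  `θᵢ = emeryLine s (lowerCorner (emeryLo εp …) (emeryHi εp …) i)` and a number `M` above the four explicit sums ⇒ `P_cell ≤ M` on the whole box — the T > 0 CAP
  order is therefore «4 × 25 KCert floors of `hubbardOpenBoxGP 1 12 (boostTau θᵢ) (blockUps θᵢ) (blockNu θᵢ)`», the same four corners as the T = 0 floor order;
* La₂CuO₄: `emeryBoxLa214v123_pressureCap_of_boostSectorFloors` at `la214v123Corner εp`.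

Everything PROVED (0 sorry); no definition. HONEST SCOPE: a door; no certificate, no number; the cap is «T = 0 sector floors + sector entropies» — crude at high T,
sharp as β → ∞ (box-p1); the 12-site boosted cluster's sectors reach dimension C(12,6)² = 853776, so which floors are certifiable is the device owner's call
(crude floors are admissible: ANY `q k ≤ E₀` works).
-/

noncomputable section

namespace Summit.Ventures.CertifiedManyBodySolver.Downfold

open NonemptyInterval Matrix Finset Literature.Probability.LatticeModels
open Literature.MathematicalPhysics.QuantumLattice Literature.Computation.Certificates ClusterLowerBound
open scoped BigOperators ComplexOrder

/-- **One coupling vector, per-CuO₂ form of box-p1's R152**: for `β ≥ 0` and floors `q k ≤ E₀(hubbardOpenBoxGP 1 12 (boostTau θ) (blockUps θ) (blockNu θ), k)`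
(`k ≤ 24`): `P_cell(β, θ) ≤ ¼ · log Σ_{p,p' ∈ [0,12]} C(12,p)·C(12,p')·e^{−β q(p+p')}` (`emeryCellPressure_le_of_boost_sector_floors` ÷ 4). [cite: Ruelle1969, §3.4] -/
theorem emeryCellPressure_le_of_boostSectorFloors {β : ℝ} (hβ : 0 ≤ β) (θ : Fin 14 → ℝ) {q : ℕ → ℝ}
    (hq : ∀ k ≤ 2 * (1 * 12), q k ≤ groundEnergy (hubbardOpenBoxGP 1 12 (boostTau θ) (blockUps θ) (blockNu θ)) k) :
    emeryCellPressure β θ ≤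
      Real.log (∑ p ∈ Finset.range (1 * 12 + 1), ∑ p' ∈ Finset.range (1 * 12 + 1),
        (((1 * 12).choose p * (1 * 12).choose p' : ℕ) : ℝ) * Real.exp (-(β * q (p + p')))) / 4 := by
  have h := emeryCellPressure_le_of_boost_sector_floors hβ θ hq
  linarith

/-- **THE THERMAL CAP ORDER IN DEVICE FORM.** A typed Emery box with the five seam entries, `β ≥ 0`, sign pattern `s`, reference level `εp`; at each lower-face
corner `θᵢ = emeryLine s (lowerCorner lo hi i)` sector floors `q i k ≤ E₀(boosted Cu₄O₈ block at θᵢ, k)` (`k ≤ 24`), and ONE number `M` dominating the four explicit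
sums `¼ log Σ C(12,p)C(12,p') e^{−β qᵢ(p+p')}` ⇒ the CAP WORD `p ↦ emeryCellPressure β (emeryLine s (emeryLineCoords εp p)) ≤ M` on the whole box.
[cite: Ruelle1969, §3.4] [cite: Israel1979, Thm. I.3.4] -/
theorem holdsOn_emeryCellPressureCap_of_boostSectorFloors {E : EmeryBox} {eA eB eD eUd eUp : Entry} {εp : ℚ}
    (hA : E .tpd = some eA) (hB : E .tpp = some eB) (hD : E .DeltaPd = some eD)
    (hUd : E .Udd = some eUd) (hUp : E .Upp = some eUp) (s : Fin 4 → ℝ) {β : ℝ} (hβ : 0 ≤ β) (q : Fin 4 → ℕ → ℝ)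
    (hq : ∀ i : Fin 4, ∀ k ≤ 2 * (1 * 12), q i k ≤
      groundEnergy (hubbardOpenBoxGP 1 12
        (boostTau (emeryLine s (lowerCorner (emeryLo εp eA eB eD eUd eUp) (emeryHi εp eA eB eD eUd eUp) i)))
        (blockUps (emeryLine s (lowerCorner (emeryLo εp eA eB eD eUd eUp) (emeryHi εp eA eB eD eUd eUp) i)))
        (blockNu (emeryLine s (lowerCorner (emeryLo εp eA eB eD eUd eUp) (emeryHi εp eA eB eD eUd eUp) i)))) k)
    {M : ℝ} (hM : ∀ i : Fin 4, Real.log (∑ p ∈ Finset.range (1 * 12 + 1), ∑ p' ∈ Finset.range (1 * 12 + 1),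
        (((1 * 12).choose p * (1 * 12).choose p' : ℕ) : ℝ) * Real.exp (-(β * q i (p + p')))) / 4 ≤ M) :
    HoldsOn (fun p : EmeryCoord → ℝ => emeryCellPressure β (emeryLine s (emeryLineCoords (εp : ℝ) p)) ≤ M) E :=
  holdsOn_emeryCellPressureCap_of_cornerCaps hA hB hD hUd hUp s hβ fun i => (emeryCellPressure_le_of_boostSectorFloors hβ _ (hq i)).trans (hM i)

/-- **La₂CuO₄ (#18): the thermal cap order in device form** — sector floors of the boosted `Cu₄O₈` block at the four corners `la214v123Corner εp i` (+ one dominating number)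
⇒ the cap word on `emeryBoxLa214v123`. [cite: Ruelle1969, §3.4] [cite: Israel1979, Thm. I.3.4] -/
theorem emeryBoxLa214v123_pressureCap_of_boostSectorFloors (εp : ℚ) (s : Fin 4 → ℝ) {β : ℝ} (hβ : 0 ≤ β) (q : Fin 4 → ℕ → ℝ)
    (hq : ∀ i : Fin 4, ∀ k ≤ 2 * (1 * 12), q i k ≤
      groundEnergy (hubbardOpenBoxGP 1 12 (boostTau (emeryLine s (la214v123Corner εp i))) (blockUps (emeryLine s (la214v123Corner εp i)))
        (blockNu (emeryLine s (la214v123Corner εp i)))) k)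
    {M : ℝ} (hM : ∀ i : Fin 4, Real.log (∑ p ∈ Finset.range (1 * 12 + 1), ∑ p' ∈ Finset.range (1 * 12 + 1),
        (((1 * 12).choose p * (1 * 12).choose p' : ℕ) : ℝ) * Real.exp (-(β * q i (p + p')))) / 4 ≤ M) :
    HoldsOn (fun p : EmeryCoord → ℝ => emeryCellPressure β (emeryLine s (emeryLineCoords (εp : ℝ) p)) ≤ M) emeryBoxLa214v123 :=
  emeryBoxLa214v123_pressureCap_of_cornerCaps εp s hβ fun i => (emeryCellPressure_le_of_boostSectorFloors hβ _ (hq i)).trans (hM i)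

end Summit.Ventures.CertifiedManyBodySolver.Downfold

end
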